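import Summits.FinalStateConjecture.FinalStateConjecture.Theorems.PhaseMixingCaptureWeakCosmicCensorshipMGHDCompleteNullInfinityInvariant
import Literature.Geometry.Lorentzian.CompleteDevelopmentMaximal
import Literature.Geometry.Lorentzian.MinkowskiCauchyDevelopment
import Literature.Geometry.Lorentzian.CauchyProblemProofs
import Literature.Geometry.Lorentzian.LeviCivitaProofs
import Literature.Geometry.Lorentzian.GeodesicProofs
import Literature.Geometry.Lorentzian.MinkowskiFlat
import HarnessLib

/-!
# Route `ExactKerrEnds`, crux `CensorshipAlongKerrEnds` (stmt-FinalStateConjecture-18521), line `Sketch` v3: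
# a datum with a Cauchy development WHICH IS Minkowski space is censored

Unconditional geometric core of the registered stub `stub_nonposMassCensored` of the lead skeleton
`Cruxes/CensorshipAlongKerrEnds/Lines/Sketch.lean` (v3; the base-mass `M(0) ≤ 0` branch of the line,
where rigidity of the positive mass theorem makes the base datum Minkowskian): if a datum `D` on `X`
admits a Cauchy development `𝒟` with `𝒟.toSpacetime = Minkowski.spacetime` (the conclusion of the
named fact `positive_mass_rigidity_spacetime`, Beig–Chruściel 1996, Thm. 4.1, the pattern of the
sibling file `ExactKerrEndsTameEscapeToKerrEndsMinkowskiLeaf.lean`), then EVERY maximal vacuum Cauchy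
development of `D` has complete future null infinity in the sojourn sense
(`Summit.FinalStateConjecture.HasCompleteNullInfinity`), i.e. `D` is CENSORED in the vocabulary of
the crux.

Mechanism (that of the landed `censored_trivialData`, `ExactKerrEndsTrivialDatumWitness.lean`, freed
from the particular slice `{t = 0}`):

* `minkowski_hasCompleteFutureNullInfinity_of_normalField`,
  `hasCompleteNullInfinity_of_toSpacetime_eq_minkowski` — Minkowski space has complete `𝓘⁺` w.r.t.
  ANY data map `ι : X → ℝ⁴` and normal field, in particular a Cauchy development which is Minkowski
  space has complete `𝓘⁺` w.r.t. its own data hypersurface `ι(X)` (an arbitrary Cauchy hypersurface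
  of `(ℝ⁴, η)`, not necessarily a hyperplane): `η` is null geodesically complete
  (`Minkowski.isGeodesicallyComplete_smoothMetric`), so every normalised null ray from `ι(X)` is
  defined on all of `ℝ` (`hasCompleteFutureNullInfinity_of_isNullGeodesicallyComplete`, uniqueness
  of geodesics `IsGeodesicOn.eqOn_of_velocity_eq_holds`);
* `exists_vacuum_isGeodesicallyComplete_of_toSpacetime_eq_minkowski` — such a development underlies
  a VACUUM Cauchy development (`Ric(η) = 0`, `Minkowski.isRicciFlat_holds`) which is geodesically
  complete;
* `isIsometricTo_of_isMaximal_of_toSpacetime_eq_minkowski` — hence every maximal vacuum Cauchy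
  development of `D` is isometric to it, as a development
  (`VacuumCauchyDevelopment.IsMaximal.isIsometricTo_of_isGeodesicallyComplete`: the complete one
  embeds into the maximal one by maximality and an isometric immersion of a complete connected
  Lorentz manifold into one of the same dimension is onto, O'Neill 1983, Cor. 7.29);
* `censored_of_cauchyDevelopment_eq_minkowski` (and its `∃`-form
  `censored_of_exists_cauchyDevelopment_eq_minkowski`) — and complete `𝓘⁺` is an invariant of
  isometric developments (`hasCompleteNullInfinity_iff_of_isIsometricTo`).

Also recorded: `exists_vacuum_isMaximal_of_toSpacetime_eq_minkowski` (the Minkowskian development is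
itself maximal as soon as some maximal development exists — e.g. under
`choquetBruhat_geroch_exists_mghd_cauchy`: Minkowski space is the MGHD of each of its Cauchy
hypersurfaces).

No named fact is assumed and nothing is defined.
References: Choquet-Bruhat–Geroch, CMP 14 (1969), Thm. 3; Christodoulou, CQG 16 (1999) A23,
pp. A26–A27; O'Neill 1983, Ch. 3, Ex. 3.25 and Ch. 7, Cor. 7.29; Beig–Chruściel, J. Math. Phys. 37
(1996), Thm. 4.1.
-/

set_option linter.dupNamespace false

noncomputable section

namespace Summit.FinalStateConjecture.FinalStateConjecture.Theorems.ExactKerrEnds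

open scoped Manifold ContDiff Topology
open Set Function Literature.Geometry.Lorentzian
open Summit.FinalStateConjecture (HasCompleteNullInfinity)
open Summit.FinalStateConjecture.FinalStateConjecture.Theorems.PhaseMixingCapture.WeakCosmicCensorshipMGHD
  (hasCompleteNullInfinity_iff_of_isIsometricTo)

variable {X : Type} [TopologicalSpace X] [ChartedSpace E3 X] [IsManifold (𝓡 3) ∞ X] [ConnectedSpace X]
  {D : InitialDataSet (𝓡 3) X}

/-! ### Complete `𝓘⁺` of Minkowski space w.r.t. an arbitrary data hypersurface -/

omit [ChartedSpace E3 X] [IsManifold (𝓡 3) ∞ X] [ConnectedSpace X] in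
/-- **Minkowski space has complete future null infinity w.r.t. ANY data map `ι : X → ℝ⁴` and any
normal field** (sojourn form): `η` is null geodesically complete
(`Minkowski.isGeodesicallyComplete_smoothMetric`), so by uniqueness of maximal geodesics
(`IsGeodesicOn.eqOn_of_velocity_eq_holds`; the Levi-Civita connection is `C¹`,
`isLocallyContMDiff_leviCivita_holds`) every normalised null ray from `ι(X)` has affine domain `ℝ`,
unbounded above — the first disjunct of the sojourn alternative with `B₀ = B₁ = ∅`
(`hasCompleteFutureNullInfinity_of_isNullGeodesicallyComplete`). Christodoulou, CQG 16 (1999), p. A27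
(Minkowski space); O'Neill 1983, Ch. 3, Ex. 3.25. [cite: Christodoulou1999, p. A27] -/
theorem minkowski_hasCompleteFutureNullInfinity_of_normalField (ι : X → E4)
    (ν : NormalField 𝓘(ℝ, E4) ι) :
    ∀ [Minkowski.smoothMetric.toPseudoRiemannianMetric.HasLeviCivita],
      Minkowski.smoothMetric.HasCompleteFutureNullInfinity
        (Minkowski.timeOrientation.ofLE (n' := ∞) le_top) ι ν := by
  intro _inst
  haveI : CovariantDerivative.ContMDiffCovariantDerivative
      Minkowski.smoothMetric.toPseudoRiemannianMetric.leviCivita 1 :=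
    ⟨Minkowski.smoothMetric.toPseudoRiemannianMetric.isLocallyContMDiff_leviCivita_holds
      1 (by rw [show ((1 : ℕ∞) : ℕ∞ω) + 1 = 2 by norm_num]; exact WithTop.coe_le_coe.2 le_top)
      univ isOpen_univ⟩
  refine LorentzianMetric.hasCompleteFutureNullInfinity_of_isNullGeodesicallyComplete
    IsGeodesicOn.eqOn_of_velocity_eq_holds (fun x v _ ↦ ?_) _
  exact Minkowski.isGeodesicallyComplete_smoothMetric x v

/-- **A Cauchy development which is Minkowski space has complete future null infinity** (sojourn
form, w.r.t. its own data hypersurface `ι(X)` — an arbitrary Cauchy hypersurface of `(ℝ⁴, η)`, not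
necessarily a hyperplane — and its unit normal): unbundle the development and apply
`minkowski_hasCompleteFutureNullInfinity_of_normalField`. Christodoulou, CQG 16 (1999), p. A27.
[cite: Christodoulou1999, p. A27] -/
theorem hasCompleteNullInfinity_of_toSpacetime_eq_minkowski (𝒟 : CauchyDevelopment D)
    (h𝒟 : 𝒟.toSpacetime = Minkowski.spacetime) : HasCompleteNullInfinity 𝒟 := by
  obtain ⟨𝒮, hC⟩ := 𝒟
  obtain ⟨S, ι, hι, ν, hν, hh, hk⟩ := 𝒮
  dsimp only at h𝒟
  subst h𝒟
  intro inst
  exact @minkowski_hasCompleteFutureNullInfinity_of_normalField X _ ι ν inst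

/-! ### The Minkowskian development is vacuum and complete: isometry to every MGHD, maximality -/

/-- **A Cauchy development which is Minkowski space underlies a geodesically complete VACUUM Cauchy
development** (`Ric(η) = 0`, `Minkowski.isRicciFlat_holds`; the geodesics of `η` are the straight
lines, `Minkowski.isGeodesicallyComplete_smoothMetric`). O'Neill 1983, Ch. 3, p. 80 and Ex. 3.25.
[cite: ONeill1983, Ch. 3, Example 3.25] -/
theorem exists_vacuum_isGeodesicallyComplete_of_toSpacetime_eq_minkowski (𝒟 : CauchyDevelopment D)
    (h𝒟 : 𝒟.toSpacetime = Minkowski.spacetime) :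
    ∃ 𝒟ᵥ : VacuumCauchyDevelopment D, 𝒟ᵥ.toCauchyDevelopment = 𝒟 ∧
      ∀ [𝒟ᵥ.metric.toPseudoRiemannianMetric.HasLeviCivita],
        IsGeodesicallyComplete 𝒟ᵥ.metric.toPseudoRiemannianMetric.leviCivita := by
  obtain ⟨𝒮, hC⟩ := 𝒟
  obtain ⟨S, ι, hι, ν, hν, hh, hk⟩ := 𝒮
  dsimp only at h𝒟
  subst h𝒟
  exact ⟨⟨⟨⟨Minkowski.spacetime, ι, hι, ν, hν, hh, hk⟩, hC⟩, @Minkowski.isRicciFlat_holds⟩, rfl,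
    @Minkowski.isGeodesicallyComplete_smoothMetric⟩

/-- **Every maximal vacuum Cauchy development of a datum with a Minkowskian Cauchy development is
isometric, as a development, to that Minkowskian development**: the complete vacuum development
embeds into the maximal one by maximality, and an embedding of a geodesically complete development is
onto, hence an isometry of developments (`IsMaximal.isIsometricTo_of_isGeodesicallyComplete`).
Choquet-Bruhat–Geroch 1969, Thm. 3; O'Neill 1983, Ch. 7, Cor. 7.29. [cite: ChoquetBruhatGeroch1969CMP, Thm. 3 (pp. 332–334)] -/
theorem isIsometricTo_of_isMaximal_of_toSpacetime_eq_minkowski (𝒟 : CauchyDevelopment D)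
    (h𝒟 : 𝒟.toSpacetime = Minkowski.spacetime) {𝒟' : VacuumCauchyDevelopment D}
    (h𝒟' : 𝒟'.IsMaximal) : 𝒟.IsIsometricTo 𝒟'.toCauchyDevelopment := by
  obtain ⟨𝒟ᵥ, rfl, hc⟩ := exists_vacuum_isGeodesicallyComplete_of_toSpacetime_eq_minkowski 𝒟 h𝒟
  exact h𝒟'.isIsometricTo_of_isGeodesicallyComplete hc

/-- **The Minkowskian development is itself a maximal vacuum Cauchy development as soon as the datum
has one** (e.g. under the Choquet-Bruhat–Geroch existence theorem
`choquetBruhat_geroch_exists_mghd_cauchy`): unconditional form of "Minkowski space is the MGHD of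
each of its Cauchy hypersurfaces" (`isMaximal_of_isGeodesicallyComplete_of_exists`).
Choquet-Bruhat–Geroch 1969, Thm. 3. [cite: ChoquetBruhatGeroch1969CMP, Thm. 3 (pp. 332–334)] -/
theorem exists_vacuum_isMaximal_of_toSpacetime_eq_minkowski (𝒟 : CauchyDevelopment D)
    (h𝒟 : 𝒟.toSpacetime = Minkowski.spacetime) (hex : ∃ 𝒟₀ : VacuumCauchyDevelopment D, 𝒟₀.IsMaximal) :
    ∃ 𝒟ᵥ : VacuumCauchyDevelopment D, 𝒟ᵥ.toCauchyDevelopment = 𝒟 ∧ 𝒟ᵥ.IsMaximal := by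
  obtain ⟨𝒟ᵥ, h, hc⟩ := exists_vacuum_isGeodesicallyComplete_of_toSpacetime_eq_minkowski 𝒟 h𝒟
  exact ⟨𝒟ᵥ, h, VacuumCauchyDevelopment.isMaximal_of_isGeodesicallyComplete_of_exists hc hex⟩

/-! ### Censoredness -/

/-- **A datum with a Cauchy development WHICH IS Minkowski space is censored**: every maximal vacuum
Cauchy development of it has complete future null infinity (sojourn form). It is isometric, as a
development, to the Minkowskian one (`isIsometricTo_of_isMaximal_of_toSpacetime_eq_minkowski`), which
has complete `𝓘⁺` (`hasCompleteNullInfinity_of_toSpacetime_eq_minkowski`), and complete `𝓘⁺` is an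
invariant of isometric developments (`hasCompleteNullInfinity_iff_of_isIsometricTo`). This is the
geometric (unconditional) core of stub `stub_nonposMassCensored` of line `Sketch` v3 of the crux; the
Minkowskian development is supplied there by the rigidity case of the positive mass theorem.
Christodoulou, CQG 16 (1999), pp. A26–A27; Choquet-Bruhat–Geroch 1969, Thm. 3. [cite: Christodoulou1999, pp. A26–A27] -/
theorem censored_of_cauchyDevelopment_eq_minkowski :
    ∀ (X : Type) [TopologicalSpace X] [ChartedSpace E3 X] [IsManifold (𝓡 3) ∞ X] [T2Space X]
      [SecondCountableTopology X] [ConnectedSpace X] (D : InitialDataSet (𝓡 3) X),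
      ∀ 𝒟 : CauchyDevelopment D, 𝒟.toSpacetime = Minkowski.spacetime →
        ∀ 𝒟' : VacuumCauchyDevelopment D, 𝒟'.IsMaximal →
          HasCompleteNullInfinity 𝒟'.toCauchyDevelopment :=
  fun _ _ _ _ _ _ _ _ 𝒟 h𝒟 _ h𝒟' ↦
    (hasCompleteNullInfinity_iff_of_isIsometricTo _ _
      (isIsometricTo_of_isMaximal_of_toSpacetime_eq_minkowski 𝒟 h𝒟 h𝒟')).1
        (hasCompleteNullInfinity_of_toSpacetime_eq_minkowski 𝒟 h𝒟)

/-- **Unbundled variant over an existential hypothesis** (the literal shape of the conclusion of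
`positive_mass_rigidity_spacetime`): if `D` has SOME Cauchy development which is Minkowski space,
then `D` is censored. [cite: Christodoulou1999, pp. A26–A27] -/
theorem censored_of_exists_cauchyDevelopment_eq_minkowski [T2Space X] [SecondCountableTopology X]
    (h : ∃ 𝒟 : CauchyDevelopment D, 𝒟.toSpacetime = Minkowski.spacetime) :
    ∀ 𝒟' : VacuumCauchyDevelopment D, 𝒟'.IsMaximal →
      HasCompleteNullInfinity 𝒟'.toCauchyDevelopment := by
  obtain ⟨𝒟, h𝒟⟩ := h
  exact censored_of_cauchyDevelopment_eq_minkowski X D 𝒟 h𝒟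

/-- **Registered sub-goal `stub_minkowskianCensored` of the crux item (stmt-FinalStateConjecture-18521):
a datum with a Cauchy development WHICH IS Minkowski space is censored** — the unconditional core of
the line's stub `stub_nonposMassCensored`, in the registry's expanded vocabulary; it IS
`censored_of_cauchyDevelopment_eq_minkowski`. [cite: Christodoulou1999, pp. A26–A27] -/
theorem stub_minkowskianCensored : ∀ (X : Type) [TopologicalSpace X] [ChartedSpace Literature.Geometry.Lorentzian.E3 X] [IsManifold (𝓡 3) ((⊤ : ℕ∞) : WithTop ℕ∞) X] [T2Space X] [SecondCountableTopology X] [ConnectedSpace X] (D : Literature.Geometry.Lorentzian.InitialDataSet (𝓡 3) X), ∀ 𝒟 : Literature.Geometry.Lorentzian.CauchyDevelopment D, 𝒟.toSpacetime = Literature.Geometry.Lorentzian.Minkowski.spacetime → ∀ 𝒟' : Literature.Geometry.Lorentzian.VacuumCauchyDevelopment D, 𝒟'.IsMaximal → Summit.FinalStateConjecture.HasCompleteNullInfinity 𝒟'.toCauchyDevelopment :=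
  censored_of_cauchyDevelopment_eq_minkowski

end Summit.FinalStateConjecture.FinalStateConjecture.Theorems.ExactKerrEnds

end
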